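import Summits.SmoothPoincare4.SmoothPoincare4.Theorems.WeakReductionDescentDependentTripleGenusThreeStandardSketchReduction
import Literature.Topology.FourManifolds.HomotopyS4OrientableProofs

/-!
# Crux `WeakReductionDescent.DependentTripleGenusThreeStandard` (stmt-SmoothPoincare4-18000), line
# `Sketch`, skeleton v9: the separating-pair step from the Aranda–Zupan Lemma 3.8 statement

Reduction glue for the registered skeleton v9 of the crux (`Cruxes/…/Lines/Sketch.lean`), filed
`--supports stmt-SmoothPoincare4-18000` (registered helpers
`helper_sepPairWeaklyReducible_of_separatingPairReducing`,
`helper_dependentTripleGenusThreeStandard_of_four_v9`).  Everything here is PROVED; the only new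
input relative to `…SketchReduction.lean` is the SHAPE of stub 3.

In v8 the separating-pair configurations (1)–(2) of Aranda–Zupan's §7 (arXiv:2503.04607, p. 24)
were carried by two stubs: 3a (configuration (1), annular chart ⇒ the disc transports; LANDED,
`stub_boundsDisc_of_annularChart`, p168238) and 3b (configuration (2) for the pair `f 0 ⊂ H_0`,
`f 1 ⊂ H_1` of a dependent triple of a `(3; 1,1,1)`-trisected homotopy 4-sphere ⇒ weakly
reducible).  v9 replaces 3b by the `3`-dimensional statement it uses, Aranda–Zupan's **Lemma 3.8**
(p. 10) read on the spine of a genus-three GK-trisection with `k_l ≤ 1` (`H_i ∪_F H_j = ∂X_l ≅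
#^{k_l}(S¹ × S²) ∈ {S³, S¹ × S²}`), with the parallel pair folded in (binder for binder the inline
hypothesis `hL38` of `DependentTripleGenusThreeTrisectionsProofs.fiveChainCase_of_separatingPair_of_pantsCase`,
at general type `k` plus orientability; proposed as the named fact
`Literature.Topology.FourManifolds.arandaZupan_separatingPair_reducing_gk`, p172489), and proves:

* `helper_sepPairWeaklyReducible_of_separatingPairReducing` — that statement ⟹ v3's stub 3
  ("a separating pair of a dependent triple makes the trisection weakly reducible", the third
  hypothesis of `helper_dependentTripleGenusThreeStandard_of_four`): the pair complement contains
  the non-empty triple complement, so it is not preconnected; `M ≃ₕ S⁴` is orientable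
  (`isOrientable_of_homotopyEquiv_sphere_four_holds`, PROVED); the statement applied to the
  splitting `H_i ∪_F H_j = ∂X_l` (`k_l = 1`) puts `f i` in `H_j` or `f j` in `H_i`, and the third
  curve `f l ⊂ H_l` completes a weak reduction (`isWeaklyReducible_of_boundsDisc_two`) — no
  relabelling of the sectors is needed (the statement is symmetric in the labels), and no case
  split on annular charts (configuration (1) is inside the statement);
* `helper_dependentTripleGenusThreeStandard_of_four_v9` — the crux BY NAME from the four v9 stubs
  (AZ25 Thm 1.3 hs-fact, MSZ16 Thm 1.2 fact, the Lemma 3.8 statement, the loop-partner step), by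
  `helper_dependentTripleGenusThreeStandard_of_four`.

References: R. Aranda, A. Zupan, arXiv:2503.04607 (2025), Lemma 3.8 (p. 10), §7 (pp. 24–25).
-/

noncomputable section

set_option linter.dupNamespace false

open scoped Manifold ContDiff Topology ContinuousMap
open Set
open Literature.Topology.FourManifolds
open Literature.Topology.FourManifolds.Trisection

namespace Summit.SmoothPoincare4.SmoothPoincare4.Theorems

/-- **A separating pair of a dependent triple makes a `(3; 1,1,1)`-trisected homotopy 4-sphere
weakly reducible — from the Aranda–Zupan Lemma 3.8 statement on spines** (PROVED glue; registered
helper of crux stmt-SmoothPoincare4-18000, line `Sketch`, skeleton v9: stub 3 ⟹ v3's stub 3).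
Hypothesis: for an orientable smooth `M` with a `(3; k)`-trisection `T` and labels `i, j, l`,
`k l ≤ 1`, disjoint non-separating curves `x ⊂ H_i`-compressing, `y ⊂ H_j`-compressing with
`F ∖ (x ∪ y)` disconnected ⟹ `x` compresses in `H_j` or `y` in `H_i` (Lemma 3.8, p. 10, with the
parallel remark of §7 p. 25 folded in).  Conclusion: for a `(3;1,1,1)`-trisected `M ≃ₕ S⁴` and an
indexed dependent triple `f` with a separating pair `f i ∪ f j`, `T` is weakly reducible.  Proof:
the pair complement contains the non-empty triple complement (not preconnected); `M` is
orientable (`isOrientable_of_homotopyEquiv_sphere_four_holds`); apply the hypothesis to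
`H_i ∪_F H_j = ∂X_l`, `k_l = 1`; the third curve `f l ⊂ H_l` completes the weak reduction
(`isWeaklyReducible_of_boundsDisc_two`). [cite: ArandaZupan2025, Lemma 3.8 (p. 10) and §7 (pp. 24–25)] -/
theorem helper_sepPairWeaklyReducible_of_separatingPairReducing :
    (∀ (M : Type) [TopologicalSpace M] [T2Space M] [SecondCountableTopology M]
      [ChartedSpace (EuclideanSpace ℝ (Fin 4)) M] [IsManifold (𝓡 4) ∞ M],
      IsOrientable (𝓡 4) M → ∀ (k : Fin 3 → ℕ) (T : Fin 3 → Set M), IsGKTrisection M 3 k T →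
      ∀ i j l : Fin 3, i ≠ j → l ≠ i → l ≠ j → k l ≤ 1 →
      ∀ x y : Set M, IsCurve T x → IsCurve T y → Disjoint x y →
        IsNonSeparating T x → IsNonSeparating T y →
        ¬ IsPreconnected (centralSurfaceSet T \ (x ∪ y)) →
        BoundsDisc T (spineHandlebody T i) x → BoundsDisc T (spineHandlebody T j) y →
        BoundsDisc T (spineHandlebody T j) x ∨ BoundsDisc T (spineHandlebody T i) y) →
    ∀ (M : Type) [TopologicalSpace M] [T2Space M] [SecondCountableTopology M]
      [ChartedSpace (EuclideanSpace ℝ (Fin 4)) M] [IsManifold (𝓡 4) ∞ M],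
      M ≃ₕ (Metric.sphere (0 : EuclideanSpace ℝ (Fin 5)) 1) → ∀ T : Fin 3 → Set M,
      IsGKTrisection M 3 (fun _ => 1) T →
      ∀ f : Fin 3 → Set M,
      (∀ i, IsCurve T (f i)) → (Pairwise fun i j => Disjoint (f i) (f j)) →
      (∀ i, IsNonSeparating T (f i)) → (∀ i, BoundsDisc T (spineHandlebody T i) (f i)) →
      ¬ IsPreconnected (centralSurfaceSet T \ ⋃ i, f i) →
      ∀ i j : Fin 3, i ≠ j → ¬ IsConnected (centralSurfaceSet T \ (f i ∪ f j)) →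
      IsWeaklyReducible T := by
  intro h38 M _ _ _ _ _ e T hT f hcur hdis hns hbd hdep i j hij hsep
  -- the third label
  have third : ∀ i j : Fin 3, i ≠ j → ∃ l : Fin 3, l ≠ i ∧ l ≠ j := by decide
  obtain ⟨l, hli, hlj⟩ := third i j hij
  -- the pair complement is non-empty (it contains the triple complement), hence not preconnected
  have hne : (centralSurfaceSet T \ (f i ∪ f j)).Nonempty := by
    have hne3 : (centralSurfaceSet T \ ⋃ m, f m).Nonempty :=
      Set.nonempty_iff_ne_empty.2 fun h => hdep (h ▸ isPreconnected_empty)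
    exact hne3.mono (Set.sdiff_subset_sdiff_right
      (union_subset (subset_iUnion f i) (subset_iUnion f j)))
  have hpre : ¬ IsPreconnected (centralSurfaceSet T \ (f i ∪ f j)) := fun h => hsep ⟨hne, h⟩
  have hM : IsOrientable (𝓡 4) M := isOrientable_of_homotopyEquiv_sphere_four_holds M e
  rcases h38 M hM (fun _ => 1) T hT i j l hij hli hlj le_rfl (f i) (f j) (hcur i) (hcur j)
      (hdis hij) (hns i) (hns j) hpre (hbd i) (hbd j) with h | h
  · -- `f i` compresses in `H_i` and in `H_j`; `f l ⊂ H_l` completes the weak reduction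
    exact isWeaklyReducible_of_boundsDisc_two (p := l) (i := i) (j := j) hij hli.symm hlj.symm
      (hcur l) (hcur i) (hdis hli) (hns l) (hns i) (hbd l) (hbd i) h
  · exact isWeaklyReducible_of_boundsDisc_two (p := l) (i := j) (j := i) hij.symm hlj.symm hli.symm
      (hcur l) (hcur j) (hdis hlj) (hns l) (hns j) (hbd l) (hbd j) h

/-- **The crux BY NAME from the four stubs of skeleton v9** (PROVED reduction; registered helper
of crux stmt-SmoothPoincare4-18000): the Aranda–Zupan Thm 1.3 homotopy-sphere fact (stub 1), the
Meier–Schirmer–Zupan classification (stub 2), the Lemma 3.8 statement on genus-three spines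
(stub 3, v9) and the loop-partner step of §7 configuration (3) (stub 4) imply
`DependentTripleGenusThreeStandard` — `helper_dependentTripleGenusThreeStandard_of_four` fed with
`helper_sepPairWeaklyReducible_of_separatingPairReducing`.
[cite: ArandaZupan2025, Thm. 1.4 and Cor. 1.5 (p. 2), Lemma 3.8 (p. 10), §7 (pp. 24–26)] [cite: MeierSchirmerZupan2016, Thm. 1.2] -/
theorem helper_dependentTripleGenusThreeStandard_of_four_v9 :
    Literature.Barriers.SmoothPoincare4.az2025_weaklyReducible_genusThree_homotopySphere_gk.{0} →
    msz_trisection_classification_gk.{0} →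
    (∀ (M : Type) [TopologicalSpace M] [T2Space M] [SecondCountableTopology M]
      [ChartedSpace (EuclideanSpace ℝ (Fin 4)) M] [IsManifold (𝓡 4) ∞ M],
      IsOrientable (𝓡 4) M → ∀ (k : Fin 3 → ℕ) (T : Fin 3 → Set M), IsGKTrisection M 3 k T →
      ∀ i j l : Fin 3, i ≠ j → l ≠ i → l ≠ j → k l ≤ 1 →
      ∀ x y : Set M, IsCurve T x → IsCurve T y → Disjoint x y →
        IsNonSeparating T x → IsNonSeparating T y →
        ¬ IsPreconnected (centralSurfaceSet T \ (x ∪ y)) →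
        BoundsDisc T (spineHandlebody T i) x → BoundsDisc T (spineHandlebody T j) y →
        BoundsDisc T (spineHandlebody T j) x ∨ BoundsDisc T (spineHandlebody T i) y) →
    (∀ (M : Type) [TopologicalSpace M] [T2Space M] [SecondCountableTopology M]
      [ChartedSpace (EuclideanSpace ℝ (Fin 4)) M] [IsManifold (𝓡 4) ∞ M],
      M ≃ₕ (Metric.sphere (0 : EuclideanSpace ℝ (Fin 5)) 1) → ∀ T : Fin 3 → Set M,
      IsGKTrisection M 3 (fun _ => 1) T →
      ∀ f : Fin 3 → Set M,
      ((∀ i, IsCurve T (f i)) ∧ (Pairwise fun i j => Disjoint (f i) (f j)) ∧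
        (∀ i, IsNonSeparating T (f i)) ∧ (∀ i, BoundsDisc T (spineHandlebody T i) (f i)) ∧
        (∀ i j, i ≠ j → IsConnected (centralSurfaceSet T \ (f i ∪ f j))) ∧
        ¬ IsPreconnected (centralSurfaceSet T \ ⋃ i, f i)) →
      ¬ IsWeaklyReducible T →
      ∃ (X' : Type) (_ : TopologicalSpace X') (_ : T2Space X') (_ : SecondCountableTopology X')
        (_ : ChartedSpace (EuclideanSpace ℝ (Fin 4)) X') (_ : IsManifold (𝓡 4) ∞ X')
        (g' : ℕ) (k' : Fin 3 → ℕ) (T' : Fin 3 → Set X')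
        (ℓ : Metric.sphere (0 : EuclideanSpace ℝ (Fin 2)) 1 → X'),
        g' ≤ 2 ∧ IsGKTrisection X' g' k' T' ∧ IsCircleSurgery (𝓡 4) (𝓡 4) X' M ℓ) →
    Summit.SmoothPoincare4.SmoothPoincare4.Theses.WeakReductionDescent.DependentTripleGenusThreeStandard :=
  fun h1 h2 h38 h4 => helper_dependentTripleGenusThreeStandard_of_four h1 h2
    (helper_sepPairWeaklyReducible_of_separatingPairReducing h38) h4

end Summit.SmoothPoincare4.SmoothPoincare4.Theorems

end
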